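import Literature.Geometry.Kaehler.ComplexTorusHolomorphicOneForms
import Literature.Geometry.Kaehler.ComplexTorusLatticeMonomials
import Mathlib.Order.Hom.PowersetCard
import Mathlib.Data.Nat.Choose.Vandermonde
import Literature.Analysis.Complex.PQDimension
import HarnessLib

/-!
# Hodge numbers and Betti numbers of a complex torus: `h^{p,q}(X) = C(g,p)·C(g,q)`, `b_k(X) = C(2g,k)`

Layer A1 of the Hodge foundations lane (`lit-hodgefound`, SKELETON.md row A1-07/A1-09). For the
complex torus `X = E/Φ(ℤ^ι)` of the tree (`Literature.Geometry.Kaehler.ComplexTorus Φ`,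
`Φ : ℝ^ι ≃L[ℝ] E` a period isomorphism, `g = dim_ℂ E`, `|ι| = 2g`), Lange–Birkenhake,
*Complex Abelian Varieties* (1992), §1.1.4–1.1.5 (held copy, PDF pp. 24–27):

* Prop. 1.1.20: "`Hⁿ(X, ℂ) ≃ IFⁿ(X)`", the classes of the `dx_{i₁} ∧ ⋯ ∧ dx_{iₙ}`, `i₁ < ⋯ < iₙ`,
  form a basis — in the tree `ComplexTorus.cconstClassEquiv : Alt^k_ℝ(E; ℂ) ≃ₗ[ℂ] H^k_dR(X; ℂ)`
  and `ComplexTorus.latMonomialBasis`, `ComplexTorus.finrank_alt_eq_card_strictMono`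
  (`dim = #{increasing words}`). Here: `card_strictMono_eq_choose` (increasing words of length `k`
  in a linearly ordered alphabet of size `m` are counted by `C(m, k)`, via Mathlib's
  `Set.powersetCard.ofFinEmbEquiv`) and **`finrank_complexDeRhamCohomology_complexTorus`**:
  `dim_ℂ H^k_dR(X; ℂ) = C(|ι|, k)` (Exercise 1.1.6 (8): "`Hⁿ(X, ℤ)` is free of rank `C(2g, n)`",
  read with complex coefficients) — PROVED.
* Thm. 1.1.21 (b) / Lemma 1.1.22 / Prop. 1.1.23: "`H^q(Ω^p_X) ≃ ⋀ᵖΩ ⊗ ⋀^qΩ̄`", "`Ω^p_X` is a free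
  `𝒪_X`-module of rank `C(g, p)`", "`Hⁿ(X, ℂ) ≃ ⊕_{p+q=n} IF^{p,q}(X) ≃ ⊕_{p+q=n} ⋀ᵖΩ ⊗ ⋀^qΩ̄`",
  hence the **Hodge numbers of a complex torus** `h^{p,q}(X) = C(g,p)·C(g,q)` (Exercise 1.1.6 (9):
  "`h^{1,1}(X) = g²`"). The tree PROVES `H^{p,q}(X) = cconstClass Φ (Λ^{p,q})`
  (`ComplexTorus.hodgePQ_eq_map_typeSubmodule`, file `Geometry/Kaehler/ComplexTorusHodgeDecomposition`)
  and `Λ^{p,q} = span {dz_I ∧ dz̄_J}` (`Analysis.Complex.typeSubmodule_eq_span_pqWord`, file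
  `Analysis/Complex/PQMonomials`, whose docstring records that the linear INDEPENDENCE of the
  increasing `(p,q)`-monomials — i.e. `dim_ℂ Λ^{p,q} = C(g,p)·C(g,q)` — is not yet proved). That
  pointwise count is vendored here as the NAMED FACT `finrank_typeSubmodule_eq_choose`
  (D-0014), and the Hodge numbers of the torus are DERIVED from it:
  **`finrank_hodgePQ_complexTorus`**. The fact is DISCHARGED (`finrank_typeSubmodule_eq_choose_holds`,
  section `Discharge`) by the tree's `Analysis.Complex.finrank_typeSubmodule`
  (`Literature/Analysis/Complex/PQDimension.lean`), whence **`finrank_hodgePQ_complexTorus_eq_choose`**: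
  `h^{p,q}(X) = C(g,p)·C(g,q)` unconditionally, `h^{1,1} = g²`, `h^{g,0} = 1`, Hodge symmetry. The bidegree-`(1,0)` instance of the fact is PROVED
  (`finrank_typeSubmodule_eq_choose_one_zero`, from the tree's `typeOneZeroEquiv`), as is the
  unconditional `h^{1,0}(X) = g` (the tree's `ComplexTorus.finrank_hodgePQ_one_zero`).

Nothing is re-defined: `typeSubmodule`, `hodgePQ`, `complexDeRhamCohomology`, `ComplexTorus` are the
tree's. Not here: the Dolbeault groups `H^q(X, Ω^p_X)` themselves (sheaf cohomology of the torus).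

## References

* H. Lange, *Abelian Varieties over the Complex Numbers*, Grundlehren Text Editions (2023) — the
  text actually held as `book:lange1992-complex-abelian-varieties` (lane ruling TRIBUNAL-A §5, key of
  record): every "PDF p." locator and every §1.1 theorem number in this file is of THIS edition;
  §1.1.4 Prop. 1.1.20, §1.1.5 Thm. 1.1.21, Lemma 1.1.22, Prop. 1.1.23, Exercise 1.1.6 (8), (9)
  (PDF pp. 24–27). [Lange2023AbelianVarietiesComplex]
* H. Lange, Ch. Birkenhake, *Complex Abelian Varieties*, Grundlehren 302 (1992), §1.1 (first
  edition of the same text; "Lange–Birkenhake" in the docstrings below). [LangeBirkenhake1992]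
* C. Voisin, *Hodge Theory and Complex Algebraic Geometry I* (2002), §2.3.1 eq. (2.4)
  (`Λ^k V_ℂ^* = ⊕ Λ^{p,q}`, `Λ^{p,q} = ⋀ᵖ V^{1,0*} ⊗ ⋀^q V^{0,1*}`). [Voisin2002]
-/

noncomputable section

open Module

namespace Literature.AlgebraicGeometry.HodgeTheory

open Literature.Analysis.Complex Literature.Geometry.Kaehler Literature.NumberTheory.Transcendental

/-! ### Counting increasing words -/

/-- **Increasing words are `k`-subsets**: the strictly increasing maps `Fin k → ι` into a finite
linearly ordered alphabet with `m` letters are counted by the binomial coefficient `C(m, k)`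
(they are the order embeddings `Fin k ↪o ι`, in bijection with the `k`-element subsets by
Mathlib's `Set.powersetCard.ofFinEmbEquiv`); the count behind "`Hⁿ(X, ℤ)` is free of rank
`C(2g, n)`" for the increasing monomials `dx_{i₁} ∧ ⋯ ∧ dx_{iₙ}`.
[cite: Lange2023AbelianVarietiesComplex, §1.1.4 Prop. 1.1.20 and Exercise 1.1.6 (8) (PDF pp. 24, 27)] -/
theorem card_strictMono_eq_choose (ι : Type*) [Fintype ι] [LinearOrder ι] (k : ℕ) :
    Fintype.card {w : Fin k → ι // StrictMono w} = (Fintype.card ι).choose k := by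
  let e : {w : Fin k → ι // StrictMono w} ≃ (Fin k ↪o ι) :=
    { toFun := fun w ↦ OrderEmbedding.ofStrictMono w.1 w.2
      invFun := fun f ↦ ⟨f, f.strictMono⟩
      left_inv := fun _ ↦ rfl
      right_inv := fun _ ↦ by ext; rfl }
  rw [Fintype.card_congr (e.trans Set.powersetCard.ofFinEmbEquiv), ← Nat.card_eq_fintype_card,
    Set.powersetCard.card, Nat.card_eq_fintype_card]

/-! ### Betti numbers of the torus (complex de Rham) -/

section Betti

variable {ι : Type*} [Fintype ι] {E : Type*} [NormedAddCommGroup E] [NormedSpace ℂ E]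
  [FiniteDimensional ℂ E] (Φ : (ι → ℝ) ≃L[ℝ] E)

/-- **`b_k(X) = C(2g, k)` for the complex torus `X = E/Φ(ℤ^ι)`, complex de Rham form**:
`dim_ℂ H^k_dR(X; ℂ) = C(|ι|, k)` (`|ι| = 2 dim_ℂ E`). Lange–Birkenhake Prop. 1.1.20 (the increasing
lattice monomials `dx_{i₁} ∧ ⋯ ∧ dx_{i_k}` give a basis of `H^k(X, ℂ)`) with Exercise 1.1.6 (8)
(rank `C(2g, k)`): the tree's `cconstClassEquiv` and `finrank_alt_eq_card_strictMono`, and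
`card_strictMono_eq_choose` for an auxiliary linear order on `ι`.
[cite: Lange2023AbelianVarietiesComplex, §1.1.4 Prop. 1.1.20 and Exercise 1.1.6 (8) (PDF pp. 24, 27)] -/
theorem finrank_complexDeRhamCohomology_complexTorus (k : ℕ) :
    finrank ℂ (complexDeRhamCohomology E (ComplexTorus Φ) k) = (Fintype.card ι).choose k := by
  letI : LinearOrder ι := LinearOrder.lift' (Fintype.equivFin ι) (Fintype.equivFin ι).injective
  rw [← (ComplexTorus.cconstClassEquiv Φ (k := k)).finrank_eq,
    ComplexTorus.finrank_alt_eq_card_strictMono Φ k, card_strictMono_eq_choose]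

end Betti

/-! ### Hodge numbers: the pointwise count (named fact) and the torus (derived) -/

section HodgeNumbers

variable (E : Type*) [NormedAddCommGroup E] [NormedSpace ℂ E] [FiniteDimensional ℂ E] (k p q : ℕ)

/-- **Named fact (pointwise Hodge numbers).** For a complex vector space `E` of dimension `g` and
`p + q = k`, the space `Λ^{p,q} ⊆ Alt^k_ℝ(E; ℂ)` of alternating `k`-forms of type `(p,q)` (the
tree's `Analysis.Complex.typeSubmodule E k p q`) has dimension `C(g,p)·C(g,q)`:
`Λ^{p,q} ≅ ⋀ᵖΩ ⊗ ⋀^qΩ̄`, `Ω = Hom_ℂ(E, ℂ)`, with basis the increasing monomials `dv_I ∧ dv̄_J`,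
`#I = p`, `#J = q` (Lange–Birkenhake (1992), §1.1.5: Lemma 1.1.22 "`Ω^p_X` is a free `𝒪_X`-module of
rank `C(g,p)`", the isomorphism `⋀ᵖΩ ⊗ ⋀^qΩ̄ → IF^{p,q}(X)` before Prop. 1.1.23, PDF pp. 25–26;
Voisin (2002), §2.3.1 eq. (2.4)). The tree proves that these monomials SPAN `Λ^{p,q}`
(`Analysis.Complex.typeSubmodule_eq_span_pqWord`); their linear independence is the content of this
fact. Discharge target: `theorem finrank_typeSubmodule_eq_choose_holds : finrank_typeSubmodule_eq_choose E k p q`.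
[cite: Lange2023AbelianVarietiesComplex, §1.1.5 Lemma 1.1.22 and Prop. 1.1.23 (PDF pp. 25–26)] -/
def finrank_typeSubmodule_eq_choose : Prop :=
  p + q = k → finrank ℂ (typeSubmodule E k p q) = (finrank ℂ E).choose p * (finrank ℂ E).choose q

variable {E k p q}

/-- **The bidegree-`(1,0)` case of the fact, PROVED**: `dim_ℂ Λ^{1,0} = g = C(g,1)·C(g,0)`, since
`Λ^{1,0} ≅ Hom_ℂ(E, ℂ)` (the tree's `typeOneZeroEquiv`) and `dim E^* = dim E`.
[cite: Lange2023AbelianVarietiesComplex, §1.1.5 Thm. 1.1.21 (b) (PDF p. 24)] -/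
theorem finrank_typeSubmodule_eq_choose_one_zero : finrank_typeSubmodule_eq_choose E 1 1 0 := by
  intro _
  rw [← (typeOneZeroEquiv (E := E)).finrank_eq,
    (LinearMap.toContinuousLinearMap : (E →ₗ[ℂ] ℂ) ≃ₗ[ℂ] (E →L[ℂ] ℂ)).symm.finrank_eq,
    Subspace.dual_finrank_eq, Nat.choose_one_right, Nat.choose_zero_right, mul_one]

variable {ι : Type*} [Fintype ι] (Φ : (ι → ℝ) ≃L[ℝ] E)

/-- **Hodge numbers of a complex torus** (Lange–Birkenhake (1992), Thm. 1.1.21 (b) with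
Prop. 1.1.23: `H^{p,q}(X) ≅ ⋀ᵖΩ ⊗ ⋀^qΩ̄`, so `h^{p,q}(X) = C(g,p)·C(g,q)`; Exercise 1.1.6 (9):
`h^{1,1}(X) = g²`), DERIVED from the pointwise fact: the tree proves
`H^{p,q}(X) = cconstClass Φ (Λ^{p,q})` (`ComplexTorus.hodgePQ_eq_map_typeSubmodule`) with
`cconstClass` an isomorphism (`ComplexTorus.cconstClassEquiv`), so `dim H^{p,q}(X) = dim Λ^{p,q}`.
[cite: Lange2023AbelianVarietiesComplex, §1.1.5 Thm. 1.1.21 (b), Prop. 1.1.23, Exercise 1.1.6 (9) (PDF pp. 24–27)] -/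
theorem finrank_hodgePQ_complexTorus (h : finrank_typeSubmodule_eq_choose E k p q) (hpq : p + q = k) :
    finrank ℂ (hodgePQ E (ComplexTorus Φ) k p q) = (finrank ℂ E).choose p * (finrank ℂ E).choose q := by
  rw [ComplexTorus.hodgePQ_eq_map_typeSubmodule, ← ComplexTorus.coe_cconstClassEquiv,
    LinearEquiv.finrank_map_eq]
  exact h hpq

/-- Unconditional bidegree `(1,0)`: `h^{1,0}(X) = g = C(g,1)·C(g,0)` (the tree's
`ComplexTorus.finrank_hodgePQ_one_zero`, restated in the binomial form of the fact).
[cite: Lange2023AbelianVarietiesComplex, §1.1.5 Thm. 1.1.21 (b) (PDF p. 24)] -/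
theorem finrank_hodgePQ_complexTorus_one_zero :
    finrank ℂ (hodgePQ E (ComplexTorus Φ) 1 1 0) = (finrank ℂ E).choose 1 * (finrank ℂ E).choose 0 :=
  finrank_hodgePQ_complexTorus Φ finrank_typeSubmodule_eq_choose_one_zero rfl

/-- For `p + q ≠ k` the Hodge piece `H^{p,q} ⊆ H^k_dR(X; ℂ)` of the torus is zero (the type
subspace `Λ^{p,q} ⊆ Alt^k` is zero off the antidiagonal; Lange–Birkenhake: `IF^{p,q}(X) ⊆ IFⁿ(X)`
only for `p + q = n`). [cite: Lange2023AbelianVarietiesComplex, §1.1.5 Prop. 1.1.23 (PDF pp. 25–26)] -/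
theorem hodgePQ_complexTorus_eq_bot_of_ne (hpq : p + q ≠ k) :
    hodgePQ E (ComplexTorus Φ) k p q = ⊥ := by
  have h0 : typeSubmodule E k p q = ⊥ := by
    rw [Submodule.eq_bot_iff]
    intro x hx
    rw [← mem_typeSubmodule_iff.1 hx, typeProjAt_of_ne hpq]
  rw [ComplexTorus.hodgePQ_eq_map_typeSubmodule, h0, Submodule.map_bot]

end HodgeNumbers

/-! ### Validation instances (TRIBUNAL-A §2, block A1): vanishing above `2g`, top degree, `∑ h^{p,q} = b_k`, `h^{0,1} = g` -/

section Validation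

open Finset

variable {ι : Type*} [Fintype ι] {E : Type*} [NormedAddCommGroup E] [NormedSpace ℂ E]
  [FiniteDimensional ℂ E]

omit [FiniteDimensional ℂ E] in
/-- The lattice of a complex torus of dimension `g` has rank `2g`: for a period isomorphism
`Φ : ℝ^ι ≃ E`, `|ι| = 2 dim_ℂ E` (Lange–Birkenhake, §1.1.1: "a lattice […] is a free abelian group
of rank `2g`"). [cite: Lange2023AbelianVarietiesComplex, §1.1.1 (PDF p. 16)] -/
theorem card_eq_two_mul_finrank_of_periodIso (Φ : (ι → ℝ) ≃L[ℝ] E) :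
    Fintype.card ι = 2 * finrank ℂ E := by
  rw [← finrank_real_of_complex E, ← LinearEquiv.finrank_eq Φ.toLinearEquiv,
    Module.finrank_fintype_fun_eq_card]

variable (Φ : (ι → ℝ) ≃L[ℝ] E)

/-- `H^k_dR(X; ℂ)` of the complex torus `X = E/Φ(ℤ^ι)` is finite-dimensional (it has the finite
basis of increasing lattice monomials, Prop. 1.1.20). [cite: Lange2023AbelianVarietiesComplex, §1.1.4 Prop. 1.1.20 (PDF p. 24)] -/
theorem finite_complexDeRhamCohomology_complexTorus (k : ℕ) :
    Module.Finite ℂ (complexDeRhamCohomology E (ComplexTorus Φ) k) := by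
  letI : LinearOrder ι := LinearOrder.lift' (Fintype.equivFin ι) (Fintype.equivFin ι).injective
  haveI : Module.Finite ℂ (E [⋀^Fin k]→L[ℝ] ℂ) :=
    Module.Finite.of_basis (ComplexTorus.latMonomialBasis Φ k)
  exact Module.Finite.equiv (ComplexTorus.cconstClassEquiv Φ (k := k))

/-- **`H^k(X) = 0` for `k > 2g`**: `dim_ℂ H^k_dR(E/Φ(ℤ^ι); ℂ) = 0` when `k > |ι|`
(`C(2g, k) = 0`; Lange–Birkenhake Exercise 1.1.6 (8)). [cite: Lange2023AbelianVarietiesComplex, §1.1.3 Exercise 1.1.6 (8) (PDF p. 27)] -/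
theorem finrank_complexDeRhamCohomology_complexTorus_eq_zero_of_lt {k : ℕ} (hk : Fintype.card ι < k) :
    finrank ℂ (complexDeRhamCohomology E (ComplexTorus Φ) k) = 0 := by
  rw [finrank_complexDeRhamCohomology_complexTorus, Nat.choose_eq_zero_of_lt hk]

/-- **Top degree**: `dim_ℂ H^{2g}_dR(E/Φ(ℤ^ι); ℂ) = 1` (`C(2g, 2g) = 1`; the class of
`dx₁ ∧ ⋯ ∧ dx_{2g}`). [cite: Lange2023AbelianVarietiesComplex, §1.1.4 Prop. 1.1.20 and Exercise 1.1.6 (8) (PDF pp. 24, 27)] -/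
theorem finrank_complexDeRhamCohomology_complexTorus_top :
    finrank ℂ (complexDeRhamCohomology E (ComplexTorus Φ) (Fintype.card ι)) = 1 := by
  rw [finrank_complexDeRhamCohomology_complexTorus, Nat.choose_self]

/-- **`b₁ = 2g`**: `dim_ℂ H¹_dR(E/Φ(ℤ^ι); ℂ) = |ι| = 2 dim_ℂ E`.
[cite: Lange2023AbelianVarietiesComplex, §1.1.3 Lemma 1.1.17 and §1.1.4 Prop. 1.1.20 (PDF pp. 23–24)] -/
theorem finrank_complexDeRhamCohomology_complexTorus_one :
    finrank ℂ (complexDeRhamCohomology E (ComplexTorus Φ) 1) = 2 * finrank ℂ E := by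
  rw [finrank_complexDeRhamCohomology_complexTorus, Nat.choose_one_right,
    card_eq_two_mul_finrank_of_periodIso Φ]

/-- **`∑_{p+q=k} h^{p,q}(X) = b_k(X) = C(2g, k)` for the complex torus**, PROVED unconditionally
(the tribunal's Vandermonde check): the Hodge pieces `H^{p,q}(X) ⊆ H^k_dR(X; ℂ)`, `p + q = k`, form
an internal direct sum (`ComplexTorus.isInternal_hodgePQ`, Prop. 1.1.23), so their dimensions add
up to `dim H^k_dR = C(|ι|, k)` (`Module.finrank_directSum`).
[cite: Lange2023AbelianVarietiesComplex, §1.1.5 Prop. 1.1.23 (PDF p. 26)] [cite: Voisin2002, §6.1.3 Prop. 6.11] -/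
theorem sum_finrank_hodgePQ_complexTorus (k : ℕ) :
    ∑ pq ∈ antidiagonal k, finrank ℂ (hodgePQ E (ComplexTorus Φ) k pq.1 pq.2) =
      (Fintype.card ι).choose k := by
  haveI := finite_complexDeRhamCohomology_complexTorus Φ k
  let e := LinearEquiv.ofBijective
    (DirectSum.coeLinearMap fun pq : ↥(antidiagonal k) ↦ hodgePQ E (ComplexTorus Φ) k pq.1.1 pq.1.2)
    (ComplexTorus.isInternal_hodgePQ Φ k)
  rw [← finrank_complexDeRhamCohomology_complexTorus Φ k, ← e.finrank_eq, Module.finrank_directSum,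
    ← Finset.sum_coe_sort (antidiagonal k)]

/-- **`h^{0,1}(X) = g`** for the complex torus `X = E/Φ(ℤ^ι)`, PROVED unconditionally:
`h^{1,0} + h^{0,1} = b₁ = 2g` (`sum_finrank_hodgePQ_complexTorus`) and `h^{1,0} = g`
(`ComplexTorus.finrank_hodgePQ_one_zero`); Lange–Birkenhake Thm. 1.1.21 (b): `H^{0,1} ≅ Ω̄`,
`dim Ω̄ = g`. For `g = 1` this is the tribunal's `h^{1,0} = h^{0,1} = 1`.
[cite: Lange2023AbelianVarietiesComplex, §1.1.5 Thm. 1.1.21 (b) (PDF p. 24)] -/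
theorem finrank_hodgePQ_complexTorus_zero_one :
    finrank ℂ (hodgePQ E (ComplexTorus Φ) 1 0 1) = finrank ℂ E := by
  have hsum := sum_finrank_hodgePQ_complexTorus Φ 1
  rw [Finset.Nat.sum_antidiagonal_eq_sum_range_succ_mk, Finset.sum_range_succ,
    Finset.sum_range_succ, Finset.sum_range_zero, zero_add, Nat.choose_one_right,
    card_eq_two_mul_finrank_of_periodIso Φ] at hsum
  have hsum' : finrank ℂ (hodgePQ E (ComplexTorus Φ) 1 0 1) +
      finrank ℂ (hodgePQ E (ComplexTorus Φ) 1 1 0) = 2 * finrank ℂ E := by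
    simpa using hsum
  have h10 : finrank ℂ (hodgePQ E (ComplexTorus Φ) 1 1 0) = finrank ℂ E :=
    ComplexTorus.finrank_hodgePQ_one_zero Φ
  omega

/-- **Hodge symmetry in degree one for the torus**: `h^{1,0}(X) = h^{0,1}(X)` (`= g`).
[cite: Lange2023AbelianVarietiesComplex, §1.1.5 Thm. 1.1.21 (b) (PDF p. 24)] -/
theorem finrank_hodgePQ_complexTorus_one_zero_eq_zero_one :
    finrank ℂ (hodgePQ E (ComplexTorus Φ) 1 1 0) = finrank ℂ (hodgePQ E (ComplexTorus Φ) 1 0 1) := by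
  rw [finrank_hodgePQ_complexTorus_zero_one, ComplexTorus.finrank_hodgePQ_one_zero]

/-- **Hodge symmetry `h^{p,q} = h^{q,p}` for the torus**, from the pointwise count (the named fact
`finrank_typeSubmodule_eq_choose` in both bidegrees): `C(g,p)C(g,q) = C(g,q)C(g,p)`.
[cite: Lange2023AbelianVarietiesComplex, §1.1.5 Thm. 1.1.21 (b) ("in particular `h^p(Ω^q_X) = h^q(Ω^p_X)`", PDF p. 24)] -/
theorem finrank_hodgePQ_complexTorus_symm {k p q : ℕ} (hpq : p + q = k)
    (h : finrank_typeSubmodule_eq_choose E k p q) (h' : finrank_typeSubmodule_eq_choose E k q p) :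
    finrank ℂ (hodgePQ E (ComplexTorus Φ) k p q) = finrank ℂ (hodgePQ E (ComplexTorus Φ) k q p) := by
  rw [finrank_hodgePQ_complexTorus Φ h hpq, finrank_hodgePQ_complexTorus Φ h' (by omega), mul_comm]

omit [FiniteDimensional ℂ E] in
include Φ in
/-- **Vandermonde consistency of the fact**: if `dim Λ^{p,q} = C(g,p)C(g,q)` for all `p + q = k`
then summing the Hodge numbers of the torus recovers `b_k = C(2g,k)` — i.e. the named fact is
compatible with `sum_finrank_hodgePQ_complexTorus` through `∑_{p+q=k} C(g,p)C(g,q) = C(2g,k)`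
(Mathlib's `Nat.add_choose_eq`). [cite: Lange2023AbelianVarietiesComplex, §1.1.5 Prop. 1.1.23 and Exercise 1.1.6 (8) (PDF pp. 26–27)] -/
theorem sum_choose_mul_choose_eq_card_choose (k : ℕ) :
    ∑ pq ∈ antidiagonal k, (finrank ℂ E).choose pq.1 * (finrank ℂ E).choose pq.2 =
      (Fintype.card ι).choose k := by
  rw [card_eq_two_mul_finrank_of_periodIso Φ, two_mul, Nat.add_choose_eq]

end Validation

/-! ### Discharge of the named fact; the Hodge numbers of a complex torus unconditionally -/

section Discharge

variable {E : Type*} [NormedAddCommGroup E] [NormedSpace ℂ E] [FiniteDimensional ℂ E] {k p q : ℕ}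

/-- **DISCHARGE of `finrank_typeSubmodule_eq_choose`** (D-0014): `dim_ℂ Λ^{p,q}(E) = C(g,p)·C(g,q)`
for `p + q = k` is the tree's theorem `Analysis.Complex.finrank_typeSubmodule`
(`Literature/Analysis/Complex/PQDimension.lean`, dimension squeeze through the type decomposition,
the representative monomials `dz_U ∧ dz̄_W` and Vandermonde).
[cite: Lange2023AbelianVarietiesComplex, §1.1.5 Lemma 1.1.22 and Prop. 1.1.23 (PDF pp. 25–26)] -/
theorem finrank_typeSubmodule_eq_choose_holds : finrank_typeSubmodule_eq_choose E k p q :=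
  fun hpq ↦ finrank_typeSubmodule hpq

variable {ι : Type*} [Fintype ι] (Φ : (ι → ℝ) ≃L[ℝ] E)

/-- **The Hodge numbers of a complex torus, unconditionally**: for `X = E/Φ(ℤ^ι)` of dimension
`g = dim_ℂ E` and `p + q = k`, `h^{p,q}(X) = dim_ℂ H^{p,q}(X) = C(g,p)·C(g,q)` (Lange–Birkenhake
(1992), Thm. 1.1.21 (b) with Prop. 1.1.23: `H^{p,q}(X) ≅ ⋀ᵖΩ ⊗ ⋀^qΩ̄`).
[cite: Lange2023AbelianVarietiesComplex, §1.1.5 Thm. 1.1.21 (b) and Prop. 1.1.23 (PDF pp. 24–26)] -/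
theorem finrank_hodgePQ_complexTorus_eq_choose (hpq : p + q = k) :
    finrank ℂ (hodgePQ E (ComplexTorus Φ) k p q) = (finrank ℂ E).choose p * (finrank ℂ E).choose q :=
  finrank_hodgePQ_complexTorus Φ finrank_typeSubmodule_eq_choose_holds hpq

/-- **Hodge symmetry `h^{p,q}(X) = h^{q,p}(X)` for the complex torus**, unconditionally
("in particular `h^p(Ω^q_X) = h^q(Ω^p_X)`"). [cite: Lange2023AbelianVarietiesComplex, §1.1.5 Thm. 1.1.21 (b) (PDF p. 24)] -/
theorem finrank_hodgePQ_complexTorus_symm' (hpq : p + q = k) :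
    finrank ℂ (hodgePQ E (ComplexTorus Φ) k p q) = finrank ℂ (hodgePQ E (ComplexTorus Φ) k q p) :=
  finrank_hodgePQ_complexTorus_symm Φ hpq finrank_typeSubmodule_eq_choose_holds
    finrank_typeSubmodule_eq_choose_holds

/-- **`h^{1,1}(X) = g²`** for a complex torus of dimension `g` (Lange–Birkenhake Exercise 1.1.6 (9)).
[cite: Lange2023AbelianVarietiesComplex, §1.1.3 Exercise 1.1.6 (9) (PDF p. 27)] -/
theorem finrank_hodgePQ_complexTorus_one_one :
    finrank ℂ (hodgePQ E (ComplexTorus Φ) 2 1 1) = finrank ℂ E ^ 2 := by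
  rw [finrank_hodgePQ_complexTorus_eq_choose Φ (k := 2) (p := 1) (q := 1) rfl, Nat.choose_one_right, sq]

/-- **`h^{g,0}(X) = h^{0,g}(X) = 1`**: the top holomorphic degree of a `g`-dimensional complex torus
(`⋀ᵍΩ` is a line, `dv₁ ∧ ⋯ ∧ dv_g`). [cite: Lange2023AbelianVarietiesComplex, §1.1.5 Lemma 1.1.22 and Prop. 1.1.23 (PDF pp. 25–26)] -/
theorem finrank_hodgePQ_complexTorus_top_zero :
    finrank ℂ (hodgePQ E (ComplexTorus Φ) (finrank ℂ E) (finrank ℂ E) 0) = 1 := by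
  rw [finrank_hodgePQ_complexTorus_eq_choose Φ (k := finrank ℂ E) (p := finrank ℂ E) (q := 0) rfl,
    Nat.choose_self, Nat.choose_zero_right]

end Discharge

end Literature.AlgebraicGeometry.HodgeTheory

end
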